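import Summits.FinalStateConjecture.FinalStateConjecture.Theses.TangentConeAtIPlus
import Summits.FinalStateConjecture.FinalStateConjecture.Theorems.PhotonSphereChannelsEndVisibleOuterRegion
import HarnessLib

/-!
# Birth skeleton — crux stmt-FinalStateConjecture-17673 `Theses.TangentConeAtIPlus.SettledExteriorHoldsRays` (K5, rank 6;
# shared with `Theses.RaychaudhuriBlowdown.SettledExteriorHoldsRays`, same signature)
# line `birth` (skeleton registrar planner-skel-stmt-FinalStateConjecture-17673-0, 2026-08-17; BC3 of run/shared/lean/lens3/_common/BC.md)

The crux (K5): for EVERY admissible datum `D`, every MGHD `𝒟` with complete `𝓘⁺` (sojourn form) and EVERY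
sub-extremal, honest (`O = exteriorOf 𝒟 fd.charted = J⁺(ιX) ∩ I⁻(charted)`), exhaustive, future-oriented
`2`-decomposition `fd` of `O`: `RaysStayInClosure 𝒟 O` — every point `γ t`, `t ≥ 0`, of every future-complete
normalised null ray from the data lies in `closure O`.

WHAT THE TREE ALREADY KNOWS (and why the route header's foreseen split `NoCompleteRayInside →
HorizonRaysAreLimits` is degenerate as typed). By outer-region ADHERENCE (landed,
`EndVisible.mem_closure_outerRegion`, O'Neill Lemma 14.6) every complete-ray point `γ t` lies in the closure
of the intrinsic future domain of outer communications `outerRegion 𝒟 = J⁺(ιX) ∩ I⁻(all complete rays from Σ)`,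
so with the intrinsic black-hole region `𝓑 = M ∖ J⁻(𝓘⁺)` the "interior step" ("no complete ray from `Σ` has a
point in `𝓑`") is a tautology of the definitions, and the crux is EXACTLY one closure-free set inclusion
(landed iff `EndVisible.raysStayInClosure_exteriorOf_iff_outerRegion_subset`):

    outerRegion 𝒟 ⊆ exteriorOf 𝒟 fd.charted,   i.e.   J⁺(ιX) ∩ I⁻(complete rays) ⊆ I⁻(fd.charted):

"the chronological past of the charted late region swallows the whole domain of outer communications computed
from ALL future-complete null geodesics from `Σ`". The genuine cut of THAT inclusion is along END-VISIBILITY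
(tree vocabulary `Theorems/PhotonSphereChannelsEndVisibleDefs.lean`, namespace `…Theorems.EndVisible`;
`endVisibleRegion 𝒟` = the events seen by complete rays launched outside EVERY compact piece of the data =
the asymptotically flat end's own `J⁻(𝓘⁺)`):

* `stub_chartsShadowEndVisibleRegion` (S, CHART-SIDE, L): under the crux hypotheses,
  `endVisibleRegion 𝒟 ∩ J⁺(ιX) ⊆ exteriorOf 𝒟 fd.charted` — every event to the future of the data that the
  far end can see is in the chronological past of the charted region of ANY honest exhaustive decomposition.
  Content: the flat chart of an honest `fd` (open embedding of the late half-space minus sublinear tubes,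
  `Φ^*g → η` in unweighted `C²` on whole slabs, image inside `O ⊆ J⁺(ιX)`) cannot tilt to null in a sector and
  miss late retarded times: every far-launched future-complete ray keeps returning to `J⁻(fd.charted)` (it is
  eventually in the radiation zone, or orbits/hovers in `J⁻` of a near zone; a far-launched ray entering a
  hole beyond the Kerr–Schild collar does so near `i⁺`, where the `C⁰`-stable Cauchy horizon makes it
  incomplete — the only interior input, and it is the PERTURBATIVE one, arXiv:1710.01722). Why it might fail:
  a legal flat chart whose slab images become asymptotically null in some direction (a slowly varying boost
  field is `C²`-invisible in chart components) so that a family of outgoing far rays never meets `I⁻(charted)`;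
  or a far-launched complete infalling ray in a non-generic late interior.
* `stub_noHiddenCompleteRays` (N, INTERIOR/TOPOLOGY, XL, operator-contingent): under the same hypotheses,
  `CompleteRaysNearEndVisible 𝒟` — every point `γ t`, `t ≥ 0`, of every future-complete normalised null ray
  from `Σ` lies in `closure (endVisibleRegion 𝒟)`: no future-complete null geodesic from `Σ` is hidden from the
  asymptotically flat end (equivalently, landed iff: `outerRegion 𝒟 ⊆ endVisibleRegion 𝒟`). Chart-free. This is
  the ∀-datum interior claim of the crux's why-might-fail (early-infalling complete rays in a smooth-Cauchy-horizon
  interior; a hidden expanding vacuum bag behind the throat of `X = ℝ³ # N` — refuter material BAG.md on item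
  stmt-17430), restricted to developments that ALSO settle honestly in the end (the only ones the crux inspects).
  TRUE on the certifiable flat class (`ChannelsResolveTameDevelopmentsR/Negative/MinkowskiEndVisible.lean`).

Composition `SettledExteriorHoldsRays_of : Sig.S → Sig.N → SettledExteriorHoldsRays` (real proof: N in set form
`outerRegion ⊆ endVisibleRegion` (landed `outerRegion_subset_endVisibleRegion_of_completeRaysNearEndVisible`),
S takes `endVisibleRegion ∩ J⁺(ιX)` into `exteriorOf 𝒟 fd.charted = O`, and adherence + push-up
(`raysStayInClosure_of_outerRegion_subset_closure`) turn `outerRegion ⊆ closure O` into the ray clause), and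
`settledExteriorHoldsRays_of_stubs : SettledExteriorHoldsRays` = the crux BY NAME modulo the two stubs.
The two stubs are the SAME cut as line `Sketch` of the sister crux stmt-17430 (K2R-T2, whose consequent carries
this clause inline), transported to the ∀-`fd` form of this shared item: N is comparable across the two cruxes,
S is new (there the decomposition is built by the prover; here it is arbitrary honest).
Disproof.lean: none exists for this crux (`ledger crux ls` empty at registration); negatives index: 1 unrelated
entry (`not_UniformPhotonSphereChannels`).
-/

set_option linter.dupNamespace false

noncomputable section

open scoped Manifold ContDiff Topology
open Filter Set Function Literature.Geometry.Lorentzian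
open Summit.FinalStateConjecture.FinalStateConjecture.Theorems

namespace Summit.FinalStateConjecture.FinalStateConjecture.Cruxes.SettledExteriorHoldsRays.Birth

open Summit.FinalStateConjecture.FinalStateConjecture.Theses.TangentConeAtIPlus (SettledExteriorHoldsRays)

/-! ## Legend: the two stub statements as named propositions (verbatim the registered signatures) -/

/-- Statement of `stub_chartsShadowEndVisibleRegion` (S): for every honest exhaustive future-oriented
sub-extremal decomposition of a censored MGHD of admissible data, `endVisibleRegion 𝒟 ∩ J⁺(ιX) ⊆ exteriorOf 𝒟 fd.charted`. -/
def Sig.stub_chartsShadowEndVisibleRegion : Prop :=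
  open Literature.Geometry.Lorentzian Summit.FinalStateConjecture.FinalStateConjecture.Theorems in open scoped Manifold ContDiff in ∀ (X : Type) [TopologicalSpace X] [ChartedSpace E3 X] [IsManifold (𝓡 3) ∞ X] [T2Space X] [SecondCountableTopology X] [ConnectedSpace X] (D : InitialDataSet (𝓡 3) X), D ∈ admissibleVacuumData X → ∀ 𝒟 : VacuumCauchyDevelopment D, 𝒟.IsMaximal → Summit.FinalStateConjecture.HasCompleteNullInfinity 𝒟.toCauchyDevelopment → ∀ (O : Set 𝒟.carrier) (fd : FinalStateDecomposition 𝒟.toSpacetime O 2), (∀ i, Kerr.IsSubextremal (fd.mass i) (fd.spin i)) → O = Summit.FinalStateConjecture.exteriorOf 𝒟.toCauchyDevelopment fd.charted → Summit.FinalStateConjecture.HasExhaustiveCharts fd → Summit.FinalStateConjecture.IsFutureOriented fd → ∀ [𝒟.metric.HasLeviCivita], EndVisible.endVisibleRegion 𝒟.toCauchyDevelopment ∩ 𝒟.metric.causalFuture 𝒟.timeOrientation (Set.range 𝒟.embed) ⊆ Summit.FinalStateConjecture.exteriorOf 𝒟.toCauchyDevelopment fd.charted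

/-- Statement of `stub_noHiddenCompleteRays` (N): for every censored MGHD of admissible data admitting an
honest exhaustive future-oriented sub-extremal decomposition, `CompleteRaysNearEndVisible 𝒟`. -/
def Sig.stub_noHiddenCompleteRays : Prop :=
  open Literature.Geometry.Lorentzian Summit.FinalStateConjecture.FinalStateConjecture.Theorems in open scoped Manifold ContDiff in ∀ (X : Type) [TopologicalSpace X] [ChartedSpace E3 X] [IsManifold (𝓡 3) ∞ X] [T2Space X] [SecondCountableTopology X] [ConnectedSpace X] (D : InitialDataSet (𝓡 3) X), D ∈ admissibleVacuumData X → ∀ 𝒟 : VacuumCauchyDevelopment D, 𝒟.IsMaximal → Summit.FinalStateConjecture.HasCompleteNullInfinity 𝒟.toCauchyDevelopment → ∀ (O : Set 𝒟.carrier) (fd : FinalStateDecomposition 𝒟.toSpacetime O 2), (∀ i, Kerr.IsSubextremal (fd.mass i) (fd.spin i)) → O = Summit.FinalStateConjecture.exteriorOf 𝒟.toCauchyDevelopment fd.charted → Summit.FinalStateConjecture.HasExhaustiveCharts fd → Summit.FinalStateConjecture.IsFutureOriented fd → EndVisible.CompleteRaysNearEndVisible 𝒟.toCauchyDevelopment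

/-! ## Registered stubs (`sorry` only here; signatures def-free over tree declarations) -/

/-- **S — THE CHARTS' PAST SWALLOWS THE END-VISIBLE DOMAIN OF OUTER COMMUNICATIONS** (chart side, L). For every
admissible datum `D`, every MGHD `𝒟` with complete `𝓘⁺` and every sub-extremal `fd : FinalStateDecomposition
𝒟.toSpacetime O 2` with `O = exteriorOf 𝒟 fd.charted`, `HasExhaustiveCharts fd`, `IsFutureOriented fd`:
`endVisibleRegion 𝒟 ∩ J⁺(ιX) ⊆ exteriorOf 𝒟 fd.charted` — every event to the causal future of the data which
lies in the chronological past of a future-complete normalised null ray launched outside any prescribed compact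
piece of `Σ` (`EndVisible.IsEndVisibleEvent`) is in `I⁻(fd.charted)`. Equivalent task: far-launched complete rays
keep returning to `J⁻(fd.charted)` (cf. `EndVisible.FarRaysShadowedBy`, which implies S by the landed
`endVisibleRegion_inter_causalFuture_subset_exteriorOf`; discharged on the flat class by
`SubMinkowski.farRaysShadowedBy_charted_subDecomp`). Plausible because the flat chart is an open embedding of the
whole late half-space minus sublinear tubes with `Φ^*g → η` in unweighted `C²` on entire slabs and image in
`J⁺(ιX)`: a Lorentzian quasi-isometric-embedding rigidity (slab images are complete, uniformly quasi-flat,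
uniformly spacelike slices — an isotropic tilt to null contradicts Euclidean volume growth, a one-directional
tilt contradicts image ⊆ `J⁺(ιX)` along the connecting slab) puts every late point of the end's `𝓘⁺` inside the
radiation zone; near-zone charts cover `{r > r₊}` so orbiting/hovering far rays stay in `J⁻(charted)`; a far ray
entering a hole beyond the collar does so near `i⁺` and is incomplete there (Dafermos–Luk `C⁰`-stable Cauchy
horizon, arXiv:1710.01722) — the only interior input, perturbative. Why it might fail: a legal flat chart whose
slab images go asymptotically null in a sector (slowly varying boosts are invisible to component-wise `C²`
closeness) so that outgoing far rays in that sector never meet `I⁻(charted)`; a complete far-launched infalling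
ray in a non-generic late interior. Sources: DafermosLuk2017 (Conjecture 1; arXiv:1710.01722), HawkingEllis1973
§9.2, ONeill1983 Ch. 14, arXiv:0811.0354 §2.6.2, Christodoulou1999 pp. A26–A27. Size: L. -/
theorem stub_chartsShadowEndVisibleRegion : open Literature.Geometry.Lorentzian Summit.FinalStateConjecture.FinalStateConjecture.Theorems in open scoped Manifold ContDiff in ∀ (X : Type) [TopologicalSpace X] [ChartedSpace E3 X] [IsManifold (𝓡 3) ∞ X] [T2Space X] [SecondCountableTopology X] [ConnectedSpace X] (D : InitialDataSet (𝓡 3) X), D ∈ admissibleVacuumData X → ∀ 𝒟 : VacuumCauchyDevelopment D, 𝒟.IsMaximal → Summit.FinalStateConjecture.HasCompleteNullInfinity 𝒟.toCauchyDevelopment → ∀ (O : Set 𝒟.carrier) (fd : FinalStateDecomposition 𝒟.toSpacetime O 2), (∀ i, Kerr.IsSubextremal (fd.mass i) (fd.spin i)) → O = Summit.FinalStateConjecture.exteriorOf 𝒟.toCauchyDevelopment fd.charted → Summit.FinalStateConjecture.HasExhaustiveCharts fd → Summit.FinalStateConjecture.IsFutureOriented fd → ∀ [𝒟.metric.HasLeviCivita],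 EndVisible.endVisibleRegion 𝒟.toCauchyDevelopment ∩ 𝒟.metric.causalFuture 𝒟.timeOrientation (Set.range 𝒟.embed) ⊆ Summit.FinalStateConjecture.exteriorOf 𝒟.toCauchyDevelopment fd.charted := by
  sorry

/-- **N — NO HIDDEN COMPLETE RAYS** (interior / topology side, XL, operator-contingent). For every admissible
datum `D`, every MGHD `𝒟` with complete `𝓘⁺` and every sub-extremal honest exhaustive future-oriented
`2`-decomposition `fd` (so: for every censored MGHD that also settles honestly in the end):
`EndVisible.CompleteRaysNearEndVisible 𝒟` — every point `γ t`, `t ≥ 0`, of every future-complete normalised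
null ray from `Σ` lies in `closure (endVisibleRegion 𝒟)`; equivalently (landed iff
`completeRaysNearEndVisible_iff_outerRegion_subset`) the domain of outer communications computed from ALL
complete rays from `Σ` is already the past of the far-launched ones, `outerRegion 𝒟 ⊆ endVisibleRegion 𝒟`.
Chart-free: the charts enter only through the hypothesis that an honest `fd` exists. This is where the crux's
∀-datum INTERIOR content lives (complete rays inside black holes must not exist unless the far end sees them:
exact sub-extremal Kerr ✓ `KerrBlackHoleNoCompleteNullRay_holds`, `Kerr.completeNullRay_mem_closure_exterior`;
flat class ✓ `Negative/MinkowskiEndVisible.lean`). Why it might fail: a hidden future-complete region behind an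
event horizon — an early-infalling complete ray in a non-generic interior with smooth complete Cauchy horizon, or
an expanding vacuum bag behind the throat of `X = ℝ³ # N` (refuter BAG.md / CruxAttack17430 §5 on stmt-17430;
operator ruling on summit clause (C) pending) — in a development whose end nevertheless settles honestly.
Sources: DafermosLuk2017 (Conjecture 1, p. 10: no interior claim), HawkingEllis1973 §9.2, Wald1984 §12.1,
Penrose1965, Sbierski2018, arXiv:1710.01722. Size: XL. -/
theorem stub_noHiddenCompleteRays : open Literature.Geometry.Lorentzian Summit.FinalStateConjecture.FinalStateConjecture.Theorems in open scoped Manifold ContDiff in ∀ (X : Type) [TopologicalSpace X] [ChartedSpace E3 X] [IsManifold (𝓡 3) ∞ X] [T2Space X] [SecondCountableTopology X] [ConnectedSpace X] (D : InitialDataSet (𝓡 3) X), D ∈ admissibleVacuumData X → ∀ 𝒟 : VacuumCauchyDevelopment D, 𝒟.IsMaximal → Summit.FinalStateConjecture.HasCompleteNullInfinity 𝒟.toCauchyDevelopment → ∀ (O : Set 𝒟.carrier) (fd : FinalStateDecomposition 𝒟.toSpacetime O 2), (∀ i, Kerr.IsSubextremal (fd.mass i) (fd.spin i)) → O = Summit.FinalStateConjecture.exteriorOf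 𝒟.toCauchyDevelopment fd.charted → Summit.FinalStateConjecture.HasExhaustiveCharts fd → Summit.FinalStateConjecture.IsFutureOriented fd → EndVisible.CompleteRaysNearEndVisible 𝒟.toCauchyDevelopment := by
  sorry

/-! ## Composition: the crux BY NAME from the two stubs (real proof, no `sorry`) -/

/-- **K5 from S and N**, pointwise in the development: N in set form puts the intrinsic domain of outer
communications inside the end-visible region (`outerRegion_subset_endVisibleRegion_of_completeRaysNearEndVisible`,
push-up through the open `I⁺(q)`); S takes its part to the causal future of the data into
`exteriorOf 𝒟 fd.charted = O`; adherence of complete-ray points to the outer region plus push-up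
(`raysStayInClosure_of_outerRegion_subset_closure`) convert `outerRegion ⊆ closure O` into the ray clause
`RaysStayInClosure 𝒟 O`. -/
theorem SettledExteriorHoldsRays_of :
    Sig.stub_chartsShadowEndVisibleRegion → Sig.stub_noHiddenCompleteRays → SettledExteriorHoldsRays := by
  intro hS hN X _ _ _ _ _ _ D hD 𝒟 hmax hscri O fd hsub hO hexh hfo
  -- N: no future-complete normalised null ray from `Σ` is hidden from the end (in `𝒟`)
  have hN' : EndVisible.CompleteRaysNearEndVisible 𝒟.toCauchyDevelopment :=
    hN X D hD 𝒟 hmax hscri O fd hsub hO hexh hfo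
  -- adherence + push-up (landed): it suffices that the outer region lies in `closure O`
  apply EndVisible.raysStayInClosure_of_outerRegion_subset_closure
  intro hLC q hq
  -- N in set form makes `q` end-visible; S puts end-visible events to the future of the data into
  -- `exteriorOf 𝒟 fd.charted`, which is `O`
  have hq' : q ∈ Summit.FinalStateConjecture.exteriorOf 𝒟.toCauchyDevelopment fd.charted :=
    hS X D hD 𝒟 hmax hscri O fd hsub hO hexh hfo
      ⟨EndVisible.outerRegion_subset_endVisibleRegion_of_completeRaysNearEndVisible hN' hq, hq.1⟩
  rw [hO]
  exact subset_closure hq'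

/-- The crux by name, closed modulo the two registered stubs. -/
theorem settledExteriorHoldsRays_of_stubs : SettledExteriorHoldsRays :=
  SettledExteriorHoldsRays_of stub_chartsShadowEndVisibleRegion stub_noHiddenCompleteRays

end Summit.FinalStateConjecture.FinalStateConjecture.Cruxes.SettledExteriorHoldsRays.Birth

end
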